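import Mathlib
import HarnessLib
import Summits.RiemannHypothesis.RiemannHypothesis.Theorems.IntegerScrewSmoothSectorDefs

/-!
# Exact first-order Euler–Maclaurin formula for the lattice profile (K♯ family, K1 inputs)

For a generator `g ∈ C¹[0,1]` with `g(1) = 0` and `∫₀¹ g = 0`, and every `y > 0`:

  `latticeProfile g y − latticePlateau g = ∫₀¹ (fract(u/y) − ½) · g′(u) du`,

i.e. `ψ(y) = h(y) − h₀ = ∫₀¹ B̃₁(u/y) g′(u) du` with `B̃₁ = fract − ½` the periodic first Bernoulli
function (split `[0,1]` at the multiples of `y`, FTC on each piece, Abel summation; the two moment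
conditions of `SmoothSectorAdmissible` are not used).  Consequence: `|ψ(y)| ≤ ½ ∫₀¹|g′|` uniformly
in `y`, and `g ↦ ψ_g(y)` is visibly linear — inputs of the density lemma for crux K1
(`CoprofileIsometry`, stmt-RiemannHypothesis-21612) and of K1a/K1b of route `SmoothSectorHardy`.

Ported verbatim (tree conventions: docstrings, split into ≤ 400-line files, `profileFun` reused from
`Theorems/SmoothSectorHardyDefs.lean`) from the desk file of rh-idea-5 g0 (family «LEMMA K♯»),
pub/ideators/rh-idea-5/ProfileBernoulli.lean v5 sha16 4e6baba130239d85 (2026-08-27), §§1–3.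
RH-free real analysis; RH is not proved by this and nothing here bears on the truth of RH.
-/

noncomputable section

set_option linter.dupNamespace false

namespace Summit.RiemannHypothesis.RiemannHypothesis.Theorems.IntegerScrew.ProfileBernoulli

open MeasureTheory Set intervalIntegral
open Summit.RiemannHypothesis.RiemannHypothesis.Theorems.IntegerScrew
open scoped BigOperators

/-! ## calculus on `[0,1]` -/

/-- A `C¹[0,1]` function has derivative `deriv g x` at interior points. [folklore] -/
theorem hasDerivAt_of_contDiffOn {g : ℝ → ℝ} (hg : ContDiffOn ℝ 1 g (Icc 0 1)) {x : ℝ}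
    (hx : x ∈ Ioo (0:ℝ) 1) : HasDerivAt g (deriv g x) x := by
  have hd : DifferentiableOn ℝ g (Icc 0 1) := hg.differentiableOn one_ne_zero
  exact ((hd x (Ioo_subset_Icc_self hx)).differentiableAt (Icc_mem_nhds hx.1 hx.2)).hasDerivAt

/-- `derivWithin g [0,1] = deriv g` at interior points. [folklore] -/
theorem derivWithin_eq_deriv_of_mem {g : ℝ → ℝ} {x : ℝ} (hx : x ∈ Ioo (0:ℝ) 1) :
    derivWithin g (Icc 0 1) x = deriv g x :=
  derivWithin_of_mem_nhds (Icc_mem_nhds hx.1 hx.2)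

/-- `g′ = derivWithin g [0,1]` is continuous on `[0,1]` for `C¹[0,1]` data. [folklore] -/
theorem continuousOn_derivWithin_Icc {g : ℝ → ℝ} (hg : ContDiffOn ℝ 1 g (Icc 0 1)) :
    ContinuousOn (derivWithin g (Icc 0 1)) (Icc 0 1) :=
  hg.continuousOn_derivWithin (uniqueDiffOn_Icc zero_lt_one) le_rfl

/-- `deriv g` is interval-integrable on `[0,1]` for `C¹[0,1]` data. [folklore] -/
theorem intervalIntegrable_deriv {g : ℝ → ℝ} (hg : ContDiffOn ℝ 1 g (Icc 0 1)) :
    IntervalIntegrable (deriv g) volume 0 1 := by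
  have h1 : IntegrableOn (derivWithin g (Icc 0 1)) (Icc 0 1) :=
    (continuousOn_derivWithin_Icc hg).integrableOn_compact isCompact_Icc
  rw [intervalIntegrable_iff_integrableOn_Ioo_of_le zero_le_one]
  exact (h1.mono_set Ioo_subset_Icc_self).congr_fun
    (fun _ hx => derivWithin_eq_deriv_of_mem hx) measurableSet_Ioo

/-- `deriv g` is interval-integrable on every `[a,b] ⊆ [0,1]`. [folklore] -/
theorem intervalIntegrable_deriv_sub {g : ℝ → ℝ} (hg : ContDiffOn ℝ 1 g (Icc 0 1)) {a b : ℝ}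
    (ha : 0 ≤ a) (hab : a ≤ b) (hb : b ≤ 1) : IntervalIntegrable (deriv g) volume a b :=
  (intervalIntegrable_deriv hg).mono_set (by
    rw [uIcc_of_le hab, uIcc_of_le zero_le_one]; exact Icc_subset_Icc ha hb)

/-- FTC on a subinterval `[a,b] ⊆ [0,1]`. -/
theorem integral_deriv_eq_sub {g : ℝ → ℝ} (hg : ContDiffOn ℝ 1 g (Icc 0 1)) {a b : ℝ}
    (ha : 0 ≤ a) (hab : a ≤ b) (hb : b ≤ 1) : ∫ u in a..b, deriv g u = g b - g a :=
  integral_eq_sub_of_hasDeriv_right_of_le hab (hg.continuousOn.mono (Icc_subset_Icc ha hb))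
    (fun x hx => (hasDerivAt_of_contDiffOn hg ⟨by linarith [hx.1], by linarith [hx.2]⟩).hasDerivWithinAt)
    (intervalIntegrable_deriv_sub hg ha hab hb)

/-- `∫₀¹ g′(u)·u du = g(1) − ∫₀¹ g`. -/
theorem integral_deriv_mul_id {g : ℝ → ℝ} (hg : ContDiffOn ℝ 1 g (Icc 0 1)) :
    ∫ u in (0:ℝ)..1, deriv g u * u = g 1 - ∫ u in (0:ℝ)..1, g u := by
  have hu : ContinuousOn (fun x : ℝ => x) (uIcc 0 1) := continuousOn_id
  have hv : ContinuousOn g (uIcc 0 1) := by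
    rw [uIcc_of_le zero_le_one]; exact hg.continuousOn
  have huu' : ∀ x ∈ Ioo (min 0 1 : ℝ) (max 0 1),
      HasDerivWithinAt (fun x : ℝ => x) (1:ℝ) (Ioi x) x := fun x _ => (hasDerivAt_id x).hasDerivWithinAt
  have hvv' : ∀ x ∈ Ioo (min 0 1 : ℝ) (max 0 1),
      HasDerivWithinAt g (deriv g x) (Ioi x) x := by
    intro x hx
    rw [min_eq_left zero_le_one, max_eq_right zero_le_one] at hx
    exact (hasDerivAt_of_contDiffOn hg hx).hasDerivWithinAt
  have hu' : IntervalIntegrable (fun _ : ℝ => (1:ℝ)) volume 0 1 := intervalIntegrable_const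
  have h := integral_mul_deriv_eq_deriv_mul_of_hasDeriv_right hu hv huu' hvv' hu'
    (intervalIntegrable_deriv hg)
  have e : (∫ u in (0:ℝ)..1, deriv g u * u) = ∫ u in (0:ℝ)..1, u * deriv g u :=
    integral_congr fun u _ => by ring
  rw [e, h]
  simp

/-! ## the lattice points `a k = min (k y) 1` -/

/-- `∑_{n ∈ Icc 1 N} g(n y) = ∑_{k < N} g((k+1) y)`. -/
theorem sum_Icc_eq_sum_range (g : ℝ → ℝ) (y : ℝ) (N : ℕ) :
    ∑ n ∈ Finset.Icc 1 N, g (n * y) = ∑ k ∈ Finset.range N, g (((k:ℝ) + 1) * y) := by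
  induction N with
  | zero => simp
  | succ N ih =>
    rw [Finset.sum_Icc_succ_top (by omega : 1 ≤ N + 1), ih, Finset.sum_range_succ]
    congr 1
    push_cast
    ring_nf

/-- MAIN THEOREM. -/
theorem profile_sub_plateau_eq {g : ℝ → ℝ} (hC : ContDiffOn ℝ 1 g (Icc 0 1)) (h1 : g 1 = 0)
    (hI : ∫ u in (0:ℝ)..1, g u = 0) {y : ℝ} (hy : 0 < y) :
    latticeProfile g y - latticePlateau g
      = ∫ u in (0:ℝ)..1, (Int.fract (u / y) - 1 / 2) * deriv g u := by
  -- notation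
  set N : ℕ := ⌊1 / y⌋₊ with hN
  set a : ℕ → ℝ := fun k => min ((k:ℝ) * y) 1 with ha_def
  have hNle : (N:ℝ) ≤ 1 / y := Nat.floor_le (by positivity)
  have hNlt : 1 / y < (N:ℝ) + 1 := Nat.lt_floor_add_one (1 / y)
  have hky : ∀ k : ℕ, k ≤ N → (k:ℝ) * y ≤ 1 := by
    intro k hk
    have : (k:ℝ) ≤ 1 / y := le_trans (by exact_mod_cast hk) hNle
    calc (k:ℝ) * y ≤ (1 / y) * y := by gcongr
      _ = 1 := by field_simp
  have ha_of_le : ∀ k : ℕ, k ≤ N → a k = (k:ℝ) * y := fun k hk => by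
    simp only [ha_def]; exact min_eq_left (hky k hk)
  have ha0 : a 0 = 0 := by simp [ha_def]
  have haN1 : a (N + 1) = 1 := by
    simp only [ha_def]
    apply min_eq_right
    have : 1 < ((N:ℝ) + 1) * y := by
      calc (1:ℝ) = (1 / y) * y := by field_simp
        _ < ((N:ℝ) + 1) * y := by gcongr
    push_cast; linarith
  have ha_nonneg : ∀ k, 0 ≤ a k := fun k => by
    simp only [ha_def]; exact le_min (by positivity) zero_le_one
  have ha_le_one : ∀ k, a k ≤ 1 := fun k => by simp only [ha_def]; exact min_le_right _ _
  have ha_mono : ∀ k, a k ≤ a (k + 1) := fun k => by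
    simp only [ha_def]
    apply min_le_min_right
    push_cast; nlinarith
  have ha_succ_le : ∀ k, a (k + 1) ≤ ((k:ℝ) + 1) * y := fun k => by
    simp only [ha_def]; push_cast; exact min_le_left _ _
  -- the integrand and its piecewise form
  set F : ℝ → ℝ := fun u => (Int.fract (u / y) - 1 / 2) * deriv g u with hF
  set P : ℕ → ℝ → ℝ := fun k u => (u / y - 1 / 2) * deriv g u - (k:ℝ) * deriv g u with hP
  have hF_meas : Measurable F := by
    apply Measurable.mul
    · exact (measurable_fract.comp (measurable_id.div_const y)).sub measurable_const
    · exact measurable_deriv g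
  have hF_int : ∀ k, IntervalIntegrable F volume (a k) (a (k + 1)) := by
    intro k
    have hd : IntervalIntegrable (fun u => ‖deriv g u‖) volume (a k) (a (k + 1)) :=
      (intervalIntegrable_deriv_sub hC (ha_nonneg k) (ha_mono k) (ha_le_one _)).norm
    refine hd.mono_fun' hF_meas.aestronglyMeasurable ?_
    refine Filter.Eventually.of_forall fun u => ?_
    simp only [hF, norm_mul, Real.norm_eq_abs]
    have h1 : |Int.fract (u / y) - 1 / 2| ≤ 1 := by
      rw [abs_le]
      constructor
      · linarith [Int.fract_nonneg (u / y)]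
      · linarith [Int.fract_lt_one (u / y)]
    calc |Int.fract (u / y) - 1 / 2| * |deriv g u| ≤ 1 * |deriv g u| := by gcongr
      _ = |deriv g u| := one_mul _
  -- Step 1: split [0,1] at the points a k
  have hsplit : (∫ u in (0:ℝ)..1, F u) = ∑ k ∈ Finset.range (N + 1), ∫ u in a k..a (k + 1), F u := by
    rw [← ha0, ← haN1]
    exact (sum_integral_adjacent_intervals fun k _ => hF_int k).symm
  -- Step 2: on piece k ≤ N, fract(u/y) = u/y - k (a.e.), so ∫ F = ∫ P k
  have hpiece : ∀ k ∈ Finset.range (N + 1),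
      (∫ u in a k..a (k + 1), F u) = ∫ u in a k..a (k + 1), P k u := by
    intro k hk
    have hkN : k ≤ N := Nat.lt_succ_iff.mp (Finset.mem_range.mp hk)
    rw [integral_of_le (ha_mono k), integral_of_le (ha_mono k),
      integral_Ioc_eq_integral_Ioo, integral_Ioc_eq_integral_Ioo]
    refine setIntegral_congr_fun measurableSet_Ioo fun u hu => ?_
    have hu1 : (k:ℝ) * y < u := by rw [← ha_of_le k hkN]; exact hu.1
    have hu2 : u < ((k:ℝ) + 1) * y := lt_of_lt_of_le hu.2 (ha_succ_le k)
    have hfr : Int.fract (u / y) = u / y - k := by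
      rw [Int.fract_eq_iff]
      refine ⟨?_, ?_, ⟨k, ?_⟩⟩
      · rw [sub_nonneg, le_div_iff₀ hy]; exact hu1.le
      · rw [sub_lt_iff_lt_add, div_lt_iff₀ hy]; linarith
      · push_cast; ring
    simp only [hF, hP, hfr]
    ring
  -- Step 3: ∫ P k = ∫ (u/y - 1/2) g' - k (g (a (k+1)) - g (a k))
  have hlin_int : ∀ k, IntervalIntegrable (fun u => (u / y - 1 / 2) * deriv g u) volume (a k) (a (k + 1)) :=
    fun k => (intervalIntegrable_deriv_sub hC (ha_nonneg k) (ha_mono k) (ha_le_one _)).continuousOn_mul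
      ((continuousOn_id.div_const y).sub continuousOn_const)
  have hP_eval : ∀ k, (∫ u in a k..a (k + 1), P k u)
      = (∫ u in a k..a (k + 1), (u / y - 1 / 2) * deriv g u) - (k:ℝ) * (g (a (k + 1)) - g (a k)) := by
    intro k
    have hdk : IntervalIntegrable (fun u => (k:ℝ) * deriv g u) volume (a k) (a (k + 1)) :=
      (intervalIntegrable_deriv_sub hC (ha_nonneg k) (ha_mono k) (ha_le_one _)).const_mul _
    simp only [hP]
    rw [intervalIntegral.integral_sub (hlin_int k) hdk, intervalIntegral.integral_const_mul,
      integral_deriv_eq_sub hC (ha_nonneg k) (ha_mono k) (ha_le_one _)]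
  -- Step 4: resum the linear part
  have hlin_sum : ∑ k ∈ Finset.range (N + 1), (∫ u in a k..a (k + 1), (u / y - 1 / 2) * deriv g u)
      = ∫ u in (0:ℝ)..1, (u / y - 1 / 2) * deriv g u := by
    rw [sum_integral_adjacent_intervals fun k _ => hlin_int k, ha0, haN1]
  -- Step 5: the linear part equals g 0 / 2
  have hlin_val : (∫ u in (0:ℝ)..1, (u / y - 1 / 2) * deriv g u) = g 0 / 2 := by
    have e : (fun u => (u / y - 1 / 2) * deriv g u)
        = fun u => (1 / y) * (deriv g u * u) - (1 / 2) * deriv g u := by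
      funext u; ring
    rw [e, intervalIntegral.integral_sub, intervalIntegral.integral_const_mul, intervalIntegral.integral_const_mul,
      integral_deriv_mul_id hC, hI, h1,
      integral_deriv_eq_sub hC le_rfl zero_le_one le_rfl, h1]
    · ring
    · exact ((intervalIntegrable_deriv hC).mul_continuousOn continuousOn_id).const_mul _
    · exact (intervalIntegrable_deriv hC).const_mul _
  -- Step 6: Abel summation of the step part
  have habel : ∑ k ∈ Finset.range (N + 1), (k:ℝ) * (g (a (k + 1)) - g (a k))
      = -latticeProfile g y := by
    have e1 : ∑ k ∈ Finset.range (N + 1), (k:ℝ) * (g (a (k + 1)) - g (a k))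
        = ∑ k ∈ Finset.range (N + 1), (k:ℝ) * g (a (k + 1))
          - ∑ k ∈ Finset.range (N + 1), (k:ℝ) * g (a k) := by
      rw [← Finset.sum_sub_distrib]; refine Finset.sum_congr rfl fun k _ => by ring
    have e2 : ∑ k ∈ Finset.range (N + 1), (k:ℝ) * g (a (k + 1))
        = ∑ k ∈ Finset.range N, (k:ℝ) * g (((k:ℝ) + 1) * y) := by
      rw [Finset.sum_range_succ, haN1, h1, mul_zero, add_zero]
      refine Finset.sum_congr rfl fun k hk => ?_
      have hk' : k + 1 ≤ N := Finset.mem_range.mp hk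
      rw [ha_of_le (k + 1) hk']; push_cast; ring_nf
    have e3 : ∑ k ∈ Finset.range (N + 1), (k:ℝ) * g (a k)
        = ∑ k ∈ Finset.range N, ((k:ℝ) + 1) * g (((k:ℝ) + 1) * y) := by
      rw [Finset.sum_range_succ']
      simp only [Nat.cast_zero, zero_mul, add_zero]
      refine Finset.sum_congr rfl fun k hk => ?_
      have hk' : k + 1 ≤ N := Finset.mem_range.mp hk
      rw [ha_of_le (k + 1) hk']; push_cast; ring_nf
    rw [e1, e2, e3, ← Finset.sum_sub_distrib, latticeProfile, sum_Icc_eq_sum_range, ← Finset.sum_neg_distrib]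
    refine Finset.sum_congr rfl fun k _ => by ring
  -- Step 7: assemble
  have hplateau : latticePlateau g = -(g 0) / 2 := rfl
  calc latticeProfile g y - latticePlateau g
      = g 0 / 2 - (-latticeProfile g y) := by rw [hplateau]; ring
    _ = (∫ u in (0:ℝ)..1, (u / y - 1 / 2) * deriv g u)
          - ∑ k ∈ Finset.range (N + 1), (k:ℝ) * (g (a (k + 1)) - g (a k)) := by rw [hlin_val, habel]
    _ = ∑ k ∈ Finset.range (N + 1), ((∫ u in a k..a (k + 1), (u / y - 1 / 2) * deriv g u)
          - (k:ℝ) * (g (a (k + 1)) - g (a k))) := by rw [Finset.sum_sub_distrib, hlin_sum]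
    _ = ∑ k ∈ Finset.range (N + 1), ∫ u in a k..a (k + 1), P k u := by
          refine Finset.sum_congr rfl fun k _ => (hP_eval k).symm
    _ = ∑ k ∈ Finset.range (N + 1), ∫ u in a k..a (k + 1), F u := by
          refine Finset.sum_congr rfl fun k hk => (hpiece k hk).symm
    _ = ∫ u in (0:ℝ)..1, F u := hsplit.symm

/-- Uniform bound: `|ψ(y)| ≤ ½ ∫₀¹ |g′|` for every `y > 0`. -/
theorem abs_profile_sub_plateau_le {g : ℝ → ℝ} (hC : ContDiffOn ℝ 1 g (Icc 0 1)) (h1 : g 1 = 0)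
    (hI : ∫ u in (0:ℝ)..1, g u = 0) {y : ℝ} (hy : 0 < y) :
    |latticeProfile g y - latticePlateau g| ≤ (1 / 2) * ∫ u in (0:ℝ)..1, |deriv g u| := by
  rw [profile_sub_plateau_eq hC h1 hI hy]
  have hb : ∀ u, |(Int.fract (u / y) - 1 / 2) * deriv g u| ≤ (1 / 2) * |deriv g u| := by
    intro u
    rw [abs_mul]
    gcongr
    rw [abs_le]
    constructor
    · linarith [Int.fract_nonneg (u / y)]
    · linarith [Int.fract_lt_one (u / y)]
  calc |∫ u in (0:ℝ)..1, (Int.fract (u / y) - 1 / 2) * deriv g u|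
      ≤ ∫ u in (0:ℝ)..1, |(Int.fract (u / y) - 1 / 2) * deriv g u| :=
        abs_integral_le_integral_abs zero_le_one
    _ ≤ ∫ u in (0:ℝ)..1, (1 / 2) * |deriv g u| := by
        apply integral_mono_on zero_le_one
        · exact ((intervalIntegrable_deriv hC).norm.mono_fun' (by
            apply Measurable.aestronglyMeasurable
            exact ((measurable_fract.comp (measurable_id.div_const y)).sub measurable_const).mul
              (measurable_deriv g)) (Filter.Eventually.of_forall fun u => by
              simp only [Real.norm_eq_abs]
              exact (hb u).trans (by linarith [abs_nonneg (deriv g u)]))).abs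
        · exact (intervalIntegrable_deriv hC).abs.const_mul _
        · intro u _; exact hb u
    _ = (1 / 2) * ∫ u in (0:ℝ)..1, |deriv g u| := intervalIntegral.integral_const_mul _ _

/-- The same for an admissible generator. -/
theorem profile_sub_plateau_eq_of_admissible {g : ℝ → ℝ} (hg : SmoothSectorAdmissible g) {y : ℝ}
    (hy : 0 < y) :
    latticeProfile g y - latticePlateau g
      = ∫ u in (0:ℝ)..1, (Int.fract (u / y) - 1 / 2) * deriv g u :=
  profile_sub_plateau_eq hg.1 hg.2.1 hg.2.2.1 hy

end Summit.RiemannHypothesis.RiemannHypothesis.Theorems.IntegerScrew.ProfileBernoulli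

end
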